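/-
Copyright: cell pub-balaban-gaps (YM BLITZ Y1, track G1), seat g1-p2 GEN 8 (unit `pub-balaban-gaps-g1-p2`).  Row (D4) NODE O,
JUNCTION J-3 (multi-level), THE COVARIANT AVERAGING FROM A BOND FIELD: the block transporters of `D4WalkBlockCovariantAveragingMultiLevel`
BUILT as ordered products `T(u,x′) = U_{b₁}(u)⋯U_{bₙ}(u)` of bond transporters along a contour system `Γ : x′ ↦ [b₁,…,bₙ]` (print's (3.8):
in-block contours of `≤ (d+1)L^{j}` bonds), `T̃(u,x) = U⁻_{bₙ}(u)⋯U⁻_{b₁}(u)`; the in-block window `α_T = e^{2(d+1)α₁} − 1` FROM THE BOND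
WINDOW `Σ_{b′}‖(U^±_b(u) − 1)_{cb′}‖ ≤ α₁L^{−lev x}` (print's (3.37) `|ηA′| < α₁(L^jη)^{−1}·η` on `Ω_j`) by 65's contour algebra — uniform in
`k`; then Cor. 3.5's step with the covariant averaging so constructed.  HONEST FRAMING: the bond field `U_b(u)`, its inverse family and
the contour SYSTEM are data (hypothesis SHAPES; print fixes one contour system); the flat operator is the lineage's scalar model; (D4) NOT
discharged (instance 0∕1); NOT BetaPertH, NOT continuum, NOT Clay.
-/
import Summits.QuantumFields.BalabanUV.Gaps.D4WalkBlockCovariantAveragingMultiLevel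
import Summits.QuantumFields.BalabanUV.Gaps.D4WalkBlockContourWindow

/-!
# `Gaps.D4WalkBlockCovariantContourMultiLevel` — block transporters as contour products of a bond field on [4]'s nested family:
# the in-block window from the bond window, and Cor. 3.5's step with the covariant averaging (cell pub-balaban-gaps, seat g1-p2 gen 8)

HONEST DEPENDENCY (cell pub-balaban, verbatim): continuum YM on T⁴ ⇐ BetaPertH ∧ nine spine estimates (0/9 proved);
BetaPertH ⇐ (D1) ∧ (D4) ∧ CAP+tail.

* §1 `contourT`, `contourTi` (ordered products along `Γ x`), `prod_reverse_mul_prod` (`T̃(x)T(x′)` is ONE ordered product of length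
  `|Γ x| + |Γ x′|`), **`contour_window_multiLevel`**: bond window `α₁L^{−lev}` on the bonds of `Γ x`, `Γ x′` (`x′ ∼_{lev x} x`), lengths
  `≤ (d+1)L^{lev}` ⟹ `Σ_{b′}‖(1 − T̃(u,x)T(u,x′))_{cb′}‖ ≤ e^{2(d+1)α₁} − 1` (65's `contourLetter_uniform` with `η ↦ L^{−lev x}`, `N ↦ 2(d+1)L^{lev x}`);
  `contourT_holo`, `contourTi_holo`;
* §2 **`blockWalkExpansion_covAvgContour_multiLevelTorus`** — COR. 3.5's STEP WITH THE COVARIANT AVERAGING BUILT FROM A BOND FIELD on the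
  genuine multi-level flat propagator under print's level-dependent windows: margin
  `c_μ(c_μ·1·(1·((0 + Σ_j covAlphaW α (α′ + a₊(e^{2(d+1)α₁} − 1)) j·covBW δ₁ L j)C))c_μ)c_μ < 1`, letters `covBW δ₁ L`, constants functions of
  `(d, ℓ, weight windows)` — uniform in `k`, the torus, `{Ω_j}`, the fibre, the contour system.
WHAT IT IS NOT.  `U_b = e^{iηA}` from (3.35)–(3.37) and the defects `W^±(A)` from the same `A` (74∕61a's algebra at print's scaling); (D4) 0∕1.

References: T. Bałaban, Comm. Math. Phys. **99** (1985) 389–434 [B9], (3.8) p. 392, (3.37) p. 396, (3.59)–(3.61) p. 402, (3.78) p. 406,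
Cor. 3.5 p. 407; Comm. Math. Phys. **98** (1985) 17–51 [5] (averaging operations); Comm. Math. Phys. **96** (1984) [4], (2.13)–(2.14).
-/

noncomputable section

namespace Summit.QuantumFields.BalabanUV.Gaps.D4WalkBlockCovariantContourMultiLevel

open Metric
open scoped Matrix
open Literature.MathematicalPhysics.QuantumFieldTheory.Balaban1983to89
open Literature.MathematicalPhysics.QuantumFieldTheory.Balaban1983to89.B4Reflection242 (boxDom blk)
open Literature.MathematicalPhysics.QuantumFieldTheory.Balaban1983to89.B9SectDWalk (DomBy)
open Literature.MathematicalPhysics.QuantumFieldTheory.Balaban1983to89.B9Thm34Ext (toB6)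
open Literature.MathematicalPhysics.QuantumFieldTheory.Balaban1983to89.B9Thm37GlueTorus (torusGeom)
open Literature.MathematicalPhysics.QuantumFieldTheory.Balaban1983to89.TreeLengthTorus (TPt)
open Literature.MathematicalPhysics.QuantumFieldTheory.Balaban1983to89.B5TorusCover (UT)
open Literature.MathematicalPhysics.QuantumFieldTheory.Balaban1983to89.B11SectG (RowSum)
open Literature.MathematicalPhysics.QuantumFieldTheory.Balaban1983to89.B6MultiLevelBoxOperator (N0)
open Literature.MathematicalPhysics.QuantumFieldTheory.Balaban1983to89.B6MultiLevelTorusOperator (TDomains gmlT tshift unitVec)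
open Literature.MathematicalPhysics.QuantumFieldTheory.Balaban1983to89.B6Ineq243TwoLevelBox (aNext)
open Summit.QuantumFields.BalabanUV.Gaps.D4WalkBlock (blockNorm BlockWalkExpansion)
open Summit.QuantumFields.BalabanUV.Gaps.D4WalkBlockMultiLevelGeometry (cubeML)
open Summit.QuantumFields.BalabanUV.Gaps.D4WalkBlockShiftAlgebra (covShift)
open Summit.QuantumFields.BalabanUV.Gaps.D4WalkBlockShiftWeighted (wOp covDopW covBW covAlphaW)
open Summit.QuantumFields.BalabanUV.Gaps.D4WalkBlockWeightedLettersMultiLevel (levW)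
open Summit.QuantumFields.BalabanUV.Gaps.D4WalkBlockCovariantAveragingMultiLevel (avCorr blockWalkExpansion_covAvg_multiLevelTorus)
open Summit.QuantumFields.BalabanUV.Gaps.D4WalkBlockContourWindow (contourLetter_uniform differentiableOn_listProd_entry)

variable {d : ℕ}

/-! ## §1. Contour transporters on the nested family and their in-block window -/

section Contour

variable {ℓ Mh k R : ℕ} {P : Fin (d + 1) → ℕ} (D : TDomains d ℓ Mh k P R)
variable {F : Type} [Fintype F] [DecidableEq F] {E : Type*} [NormedAddCommGroup E] [NormedSpace ℂ E] {B : Type}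
variable (Γ : ↥(boxDom (N0 ℓ Mh k P)) → List B) (Ub Ubi : E → B → Matrix F F ℂ)

/-- **The block transporter** `T(u,x) = U_{b₁}(u)⋯U_{bₙ}(u)` along the contour `Γ x = [b₁,…,bₙ]` (print's `U(Γ_{y,x})`, (3.8)). -/
def contourT (u : E) (x : ↥(boxDom (N0 ℓ Mh k P))) : Matrix F F ℂ := ((Γ x).map fun b => Ub u b).prod

/-- **The reverse transporter** `T̃(u,x) = U⁻_{bₙ}(u)⋯U⁻_{b₁}(u)` (the inverse of `T(u,x)` when `U_bU⁻_b = 1`). -/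
def contourTi (u : E) (x : ↥(boxDom (N0 ℓ Mh k P))) : Matrix F F ℂ := (((Γ x).map fun b => Ubi u b).reverse).prod

variable {D Γ Ub Ubi}

omit [NormedAddCommGroup E] [NormedSpace ℂ E] in
/-- `T̃(u,x)T(u,x′)` is ONE ordered product, of the concatenated list. -/
theorem contourTi_mul_contourT (u : E) (x x' : ↥(boxDom (N0 ℓ Mh k P))) :
    contourTi Γ Ubi u x * contourT Γ Ub u x' = ((((Γ x).map fun b => Ubi u b).reverse) ++ ((Γ x').map fun b => Ub u b)).prod := by
  unfold contourTi contourT; rw [List.prod_append]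

omit [NormedSpace ℂ E] in
/-- **THE IN-BLOCK WINDOW FROM THE BOND WINDOW** (uniform in `k`): if the contours have `|Γ x| ≤ (d+1)L^{lev x}` bonds and, on the ball,
every bond of `Γ x` carries `Σ_{b′}‖(U_b(u) − 1)_{cb′}‖ ≤ α₁L^{−lev x}` and `Σ_{b′}‖(U⁻_b(u) − 1)_{cb′}‖ ≤ α₁L^{−lev x}` (print's (3.37) at the
level of the block), then for `x′ ∼_{lev x} x`: `Σ_{b′}‖(1 − T̃(u,x)T(u,x′))_{cb′}‖ ≤ e^{2(d+1)α₁} − 1`.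
[cite: Balaban1985BackgroundPropagators, (3.8) p.392, (3.37) p.396, (3.59) p.402] -/
theorem contour_window_multiLevel {α₁ Rb : ℝ} (hα₁ : 0 ≤ α₁)
    (hlen : ∀ x : ↥(boxDom (N0 ℓ Mh k P)), (Γ x).length ≤ (d + 1) * (ℓ + 1) ^ D.lev x.1)
    (hU : ∀ u ∈ ball (0 : E) Rb, ∀ x : ↥(boxDom (N0 ℓ Mh k P)), ∀ b ∈ Γ x, ∀ c,
      ∑ b', ‖(Ub u b - 1) c b'‖ ≤ ((((ℓ : ℝ) + 1) ^ D.lev x.1)⁻¹) * α₁)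
    (hUi : ∀ u ∈ ball (0 : E) Rb, ∀ x : ↥(boxDom (N0 ℓ Mh k P)), ∀ b ∈ Γ x, ∀ c,
      ∑ b', ‖(Ubi u b - 1) c b'‖ ≤ ((((ℓ : ℝ) + 1) ^ D.lev x.1)⁻¹) * α₁) :
    ∀ u ∈ ball (0 : E) Rb, ∀ x x' : ↥(boxDom (N0 ℓ Mh k P)),
      blk ((ℓ + 1) ^ D.lev x.1) x'.1 = blk ((ℓ + 1) ^ D.lev x.1) x.1 →
        ∀ c, ∑ b', ‖(1 - contourTi Γ Ubi u x * contourT Γ Ub u x') c b'‖ ≤ Real.exp (2 * ((d : ℝ) + 1) * α₁) - 1 := by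
  intro u hu x x' hblk c
  have hlev : D.lev x'.1 = D.lev x.1 := D.lev_eq_of_blk_eq x.2 x'.2 hblk
  have hL : (0 : ℝ) < ((ℓ : ℝ) + 1) ^ D.lev x.1 := by positivity
  rw [contourTi_mul_contourT]
  set l := (((Γ x).map fun b => Ubi u b).reverse) ++ ((Γ x').map fun b => Ub u b) with hl
  have hfac : ∀ U ∈ l, ∀ c, ∑ b', ‖(U - 1) c b'‖ ≤ ((((ℓ : ℝ) + 1) ^ D.lev x.1)⁻¹) * α₁ := by
    intro U hUl c
    rw [hl, List.mem_append, List.mem_reverse, List.mem_map, List.mem_map] at hUl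
    rcases hUl with ⟨b, hb, rfl⟩ | ⟨b, hb, rfl⟩
    · exact hUi u hu x b hb c
    · have := hU u hu x' b hb c
      rwa [hlev] at this
  have hlenl : l.length ≤ 2 * ((d + 1) * (ℓ + 1) ^ D.lev x.1) := by
    rw [hl, List.length_append, List.length_reverse, List.length_map, List.length_map]
    have h1 := hlen x
    have h2 := hlen x'
    rw [hlev] at h2
    omega
  have hN : ((2 * ((d + 1) * (ℓ + 1) ^ D.lev x.1) : ℕ) : ℝ) * ((((ℓ : ℝ) + 1) ^ D.lev x.1)⁻¹) ≤ 2 * ((d : ℝ) + 1) := by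
    push_cast
    rw [show (2 : ℝ) * (((d : ℝ) + 1) * ((ℓ : ℝ) + 1) ^ D.lev x.1) * (((ℓ : ℝ) + 1) ^ D.lev x.1)⁻¹ = 2 * ((d : ℝ) + 1) by
      field_simp]
  have h := contourLetter_uniform (F := F) (inv_pos.2 hL).le hα₁ hN l hlenl hfac c
  calc ∑ b', ‖(1 - l.prod) c b'‖ = ∑ b', ‖(l.prod - 1) c b'‖ :=
        Finset.sum_congr rfl fun b' _ => by rw [← neg_sub, Matrix.neg_apply, norm_neg]
    _ ≤ Real.exp (2 * ((d : ℝ) + 1) * α₁) - 1 := h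

/-- `T(u,x)` is entrywise holomorphic when the bond transporters are. -/
theorem contourT_holo {Rb : ℝ} (hUb : ∀ b c c', DifferentiableOn ℂ (fun u => Ub u b c c') (ball (0 : E) Rb)) :
    ∀ x c c', DifferentiableOn ℂ (fun u => contourT Γ Ub u x c c') (ball (0 : E) Rb) := by
  intro x c c'
  have h := differentiableOn_listProd_entry (s := ball (0 : E) Rb) ((Γ x).map fun b => fun u => Ub u b)
    (fun U hU => by
      rw [List.mem_map] at hU
      obtain ⟨b, _, rfl⟩ := hU
      exact hUb b) c c'
  have e : (fun u => contourT Γ Ub u x c c') = fun u => (((Γ x).map fun b => fun u => Ub u b).map fun U => U u).prod c c' := by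
    funext u; unfold contourT; rw [List.map_map]; rfl
  rw [e]; exact h

/-- `T̃(u,x)` is entrywise holomorphic when the inverse bond transporters are. -/
theorem contourTi_holo {Rb : ℝ} (hUbi : ∀ b c c', DifferentiableOn ℂ (fun u => Ubi u b c c') (ball (0 : E) Rb)) :
    ∀ x c c', DifferentiableOn ℂ (fun u => contourTi Γ Ubi u x c c') (ball (0 : E) Rb) := by
  intro x c c'
  have h := differentiableOn_listProd_entry (s := ball (0 : E) Rb) (((Γ x).map fun b => fun u => Ubi u b).reverse)
    (fun U hU => by
      rw [List.mem_reverse, List.mem_map] at hU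
      obtain ⟨b, _, rfl⟩ := hU
      exact hUbi b) c c'
  have e : (fun u => contourTi Γ Ubi u x c c') =
      fun u => ((((Γ x).map fun b => fun u => Ubi u b).reverse).map fun U => U u).prod c c' := by
    funext u; unfold contourTi; rw [List.map_reverse, List.map_map]; rfl
  rw [e]; exact h

end Contour

/-! ## §2. Cor. 3.5's step with the covariant averaging built from a bond field -/

section Step

variable {dd N' : ℕ} {E : Type*} [NormedAddCommGroup E] [NormedSpace ℂ E]

/-- **[B9] COR. 3.5's STEP WITH THE COVARIANT AVERAGING BUILT FROM A BOND FIELD ALONG A CONTOUR SYSTEM, ON THE GENUINE NESTED FAMILY,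
UNDER PRINT'S LEVEL-DEPENDENT WINDOWS.**  There are `δ₁, C, M₀ > 0`, `N₀ ≥ 1` (functions of `d, ℓ`, weight windows) such that for every
admissible `(k, M_h, R, P, D, a, c, Kc)`, finite fibre, holomorphic defects with the level-dependent windows (bond `αL^{−lev x}`,
divergence `α′L^{−2lev x}`), every contour system `Γ` with `|Γ x| ≤ (d+1)L^{lev x}`, every holomorphic bond field `U_b(u)` with a
holomorphic reverse family `U⁻_b(u)`, both with the (3.37)-window `Σ_{b′}‖(U^±_b(u) − 1)_{cb′}‖ ≤ α₁L^{−lev x}` on the bonds of `Γ x`, every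
cube row sum `(μ, c_μ)`, `2μ ≤ ε`, `2μ ≤ δ₁ − ε − μ`, margin
`c_μ(c_μ·1·(1·((0 + Σ_j covAlphaW α (α′ + a₊(e^{2(d+1)α₁} − 1)) j·covBW δ₁ L j)C))c_μ)c_μ < 1`:
`(W ⊗ 1)(1 − (V_W(u) + Ã(u)(w² ⊗ 1))(W ⊗ 1))⁻¹`, `Ã` the covariant-averaging correction of the transporters `T = ΠU_b`, `T̃ = ΠʳU⁻_b`, is a
block walk expansion at `(ε − 2μ, δ₁ − ε − 3μ, c_μC(1·(1−q)⁻¹)c_μ, δ₁ − 2μ)` with the relative letters `covBW δ₁ L`, dominating distances.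
[cite: Balaban1985BackgroundPropagators, Cor. 3.5 p.407, (3.8) p.392, (3.37) p.396, (3.59)–(3.61) p.402, (3.78) p.406; Balaban1984PropagatorsII, (2.13)–(2.14) p.225; Balaban1988RG2Cluster, (1.11) p.5] -/
theorem blockWalkExpansion_covAvgContour_multiLevelTorus (d ℓ : ℕ) (hℓ : 1 ≤ ℓ) (aminus aplus a2minus a2plus : ℝ)
    (ha : 0 < aminus) (ha2 : 0 < a2minus) :
    ∃ δ₁ C M₀ : ℝ, ∃ N₀ : ℕ, 0 < δ₁ ∧ 0 < C ∧ 0 < M₀ ∧ 0 < N₀ ∧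
      ∀ (k Mh R : ℕ), 3 ≤ Mh → M₀ ≤ ((ℓ : ℝ) + 1) * Mh → 2 * (ℓ + 1) ≤ R → N₀ + 1 ≤ R * ((ℓ + 1) * Mh) →
      ∀ (P : Fin (d + 1) → ℕ) (hP : ∀ μ, 1 ≤ P μ) (hP4 : ∀ μ, 4 ≤ P μ) (D : TDomains d ℓ Mh k P R) (a c : ℕ → ℝ),
        (∀ i, 1 ≤ i → aminus ≤ a i ∧ a i ≤ aplus) → (∀ i, 1 ≤ i → a2minus ≤ c i ∧ c i ≤ a2plus) →
        (∀ i, 1 ≤ i → a (i + 1) = aNext ℓ (a i) (c i)) →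
      ∀ (Kc : Fin (d + 1) → ℕ) [∀ i, NeZero (Kc i)], (∀ i, N0 ℓ Mh k P i = (ℓ + 1) ^ k * Kc i) →
      ∀ (F : Type) [Fintype F] [DecidableEq F] (c₀ : B13.Consts) (Xs : Finset (UT Kc)) (Rb : ℝ)
        (Wp Wm : Fin (d + 1) → E → ↥(boxDom (N0 ℓ Mh k P)) → Matrix F F ℂ) (B : Type)
        (Γ : ↥(boxDom (N0 ℓ Mh k P)) → List B) (Ub Ubi : E → B → Matrix F F ℂ) (α α' α₁ ε μ cμ : ℝ),
      (∀ ν x a' b, DifferentiableOn ℂ (fun u => Wp ν u x a' b) (ball (0 : E) Rb)) →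
      (∀ ν x a' b, DifferentiableOn ℂ (fun u => Wm ν u x a' b) (ball (0 : E) Rb)) →
      (∀ b c c', DifferentiableOn ℂ (fun u => Ub u b c c') (ball (0 : E) Rb)) →
      (∀ b c c', DifferentiableOn ℂ (fun u => Ubi u b c c') (ball (0 : E) Rb)) →
      0 ≤ α → 0 ≤ α' → 0 ≤ α₁ →
      (∀ ν, ∀ u ∈ ball (0 : E) Rb, ∀ x a', ∑ b, ‖Wp ν u x a' b‖ ≤ (((ℓ : ℝ) + 1) ^ k)⁻¹ * α * levW D x) →
      (∀ ν, ∀ u ∈ ball (0 : E) Rb, ∀ x a', ∑ b, ‖Wm ν u x a' b‖ ≤ (((ℓ : ℝ) + 1) ^ k)⁻¹ * α * levW D x) →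
      (∀ u ∈ ball (0 : E) Rb, ∀ x a', ∑ b, ‖(∑ ν, (Wp ν u x + Wm ν u x)) a' b‖ ≤ ((((ℓ : ℝ) + 1) ^ k)⁻¹) ^ 2 * α' * levW D x ^ 2) →
      (∀ x : ↥(boxDom (N0 ℓ Mh k P)), (Γ x).length ≤ (d + 1) * (ℓ + 1) ^ D.lev x.1) →
      (∀ u ∈ ball (0 : E) Rb, ∀ x : ↥(boxDom (N0 ℓ Mh k P)), ∀ b ∈ Γ x, ∀ c',
        ∑ b', ‖(Ub u b - 1) c' b'‖ ≤ ((((ℓ : ℝ) + 1) ^ D.lev x.1)⁻¹) * α₁) →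
      (∀ u ∈ ball (0 : E) Rb, ∀ x : ↥(boxDom (N0 ℓ Mh k P)), ∀ b ∈ Γ x, ∀ c',
        ∑ b', ‖(Ubi u b - 1) c' b'‖ ≤ ((((ℓ : ℝ) + 1) ^ D.lev x.1)⁻¹) * α₁) →
      0 ≤ μ → 2 * μ ≤ ε → 2 * μ ≤ δ₁ - ε - μ → 0 ≤ cμ →
      RowSum (toB6 (torusGeom Kc 0 0 0) 0 True) μ cμ →
      cμ * (cμ * 1 * (1 * ((0 + ∑ j : Unit ⊕ (Fin (d + 1) ⊕ Fin (d + 1)),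
        covAlphaW α (α' + aplus * (Real.exp (2 * ((d : ℝ) + 1) * α₁) - 1)) j * covBW δ₁ ((ℓ : ℝ) + 1) j) * C)) * cμ) * cμ < 1 →
      ∃ (W : Type) (T : W → (TPt dd N' → ℂ) → E → Matrix (↥(boxDom (N0 ℓ Mh k P)) × F) (↥(boxDom (N0 ℓ Mh k P)) × F) ℂ)
        (SX' : Set W) (A' : W → ℝ) (D' : W → UT Kc → UT Kc → ℝ),
        BlockWalkExpansion c₀ (fun q : ↥(boxDom (N0 ℓ Mh k P)) × F => cubeML ℓ k Kc q.1.1)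
          (fun q : ↥(boxDom (N0 ℓ Mh k P)) × F => cubeML ℓ k Kc q.1.1)
          (fun (_ : TPt dd N' → ℂ) u =>
            Matrix.blockDiagonal (fun _ : F =>
                ((((ℓ : ℂ) + 1) ^ (2 * k))⁻¹ : ℂ) • (gmlT (N0 ℓ Mh k P) ℓ k D.lev a).map ((↑) : ℝ → ℂ)) *
              (1 - (covShift ↥(boxDom (N0 ℓ Mh k P)) F (fun ν => tshift (N0 ℓ Mh k P) (unitVec ν))
                    ((((ℓ : ℝ) + 1) ^ k)⁻¹) Wp Wm u +
                  avCorr D a (contourT Γ Ub) (contourTi Γ Ubi) u * wOp ↥(boxDom (N0 ℓ Mh k P)) F (fun x => levW D x ^ 2)) *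
                Matrix.blockDiagonal (fun _ : F =>
                  ((((ℓ : ℂ) + 1) ^ (2 * k))⁻¹ : ℂ) • (gmlT (N0 ℓ Mh k P) ℓ k D.lev a).map ((↑) : ℝ → ℂ)))⁻¹)
          Xs Rb (ε - 2 * μ) (δ₁ - ε - μ - 2 * μ)
          (cμ * C * (1 * (1 - cμ * (cμ * 1 * (1 * ((0 + ∑ j : Unit ⊕ (Fin (d + 1) ⊕ Fin (d + 1)),
            covAlphaW α (α' + aplus * (Real.exp (2 * ((d : ℝ) + 1) * α₁) - 1)) j * covBW δ₁ ((ℓ : ℝ) + 1) j) * C)) * cμ) *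
              cμ)⁻¹) * cμ)
          T SX' A' D' (δ₁ - 2 * μ) ∧
        (∀ (j : Unit ⊕ (Fin (d + 1) ⊕ Fin (d + 1))) ω (σ : TPt dd N' → ℂ), (∀ i, ‖σ i‖ ≤ Real.exp c₀.κ₁) →
          ∀ u ∈ ball (0 : E) Rb, ∀ Y Y',
          blockNorm (fun q : ↥(boxDom (N0 ℓ Mh k P)) × F => cubeML ℓ k Kc q.1.1)
              (fun q : ↥(boxDom (N0 ℓ Mh k P)) × F => cubeML ℓ k Kc q.1.1)
              (covDopW ↥(boxDom (N0 ℓ Mh k P)) F (fun ν => tshift (N0 ℓ Mh k P) (unitVec ν)) ((((ℓ : ℝ) + 1) ^ k)⁻¹) (levW D) j *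
                T ω σ u) Y Y' ≤
            covBW (ι := Fin (d + 1)) δ₁ ((ℓ : ℝ) + 1) j * (A' ω * Real.exp (-((δ₁ - 2 * μ) * D' ω Y Y')))) ∧
        ∀ ω, DomBy (toB6 (torusGeom Kc 0 0 0) 0 True) (D' ω) := by
  obtain ⟨δ₁, C, M₀, N₀, hδ₁, hC, hM₀, hN₀, hmain⟩ :=
    blockWalkExpansion_covAvg_multiLevelTorus (dd := dd) (N' := N') (E := E) d ℓ hℓ aminus aplus a2minus a2plus ha ha2
  refine ⟨δ₁, C, M₀, N₀, hδ₁, hC, hM₀, hN₀, ?_⟩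
  intro k Mh R hMh hM hR hRM P hP hP4 D a c haw hcw hac Kc _ hKc F _ _ c₀ Xs Rb Wp Wm B Γ Ub Ubi α α' α₁ ε μ cμ hWph hWmh hUbh hUbih
    hα hα' hα₁ hWp hWm hdiv hlen hU hUi hμ hμε hμκ hcμ hrow hq
  have hαT : 0 ≤ Real.exp (2 * ((d : ℝ) + 1) * α₁) - 1 := by
    have : (1 : ℝ) ≤ Real.exp (2 * ((d : ℝ) + 1) * α₁) := Real.one_le_exp (by positivity)
    linarith
  exact hmain k Mh R hMh hM hR hRM P hP hP4 D a c haw hcw hac Kc hKc F c₀ Xs Rb Wp Wm (contourT Γ Ub) (contourTi Γ Ubi) α α'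
    (Real.exp (2 * ((d : ℝ) + 1) * α₁) - 1) ε μ cμ hWph hWmh (contourT_holo hUbh) (contourTi_holo hUbih) hα hα' hαT hWp hWm hdiv
    (contour_window_multiLevel (D := D) hα₁ hlen hU hUi) hμ hμε hμκ hcμ hrow hq

end Step

end Summit.QuantumFields.BalabanUV.Gaps.D4WalkBlockCovariantContourMultiLevel

end
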